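import Summits.QuantumFields.QCD.Theorems.SpectralDefectExtinctionChiralDescentRaySoftPoint
import Summits.QuantumFields.QCD.Theorems.SpectralDefectExtinctionChiralDescentStubWallLimitNoGo
import Summits.QuantumFields.QCD.Theorems.SpectralDefectExtinctionChiralDescentWallLimit

/-!
# Crux `SpectralDefectExtinction.ChiralDescent` (stmt-QuantumFields-17527), line `gap-upset-recut` —
# THE RESIDUAL SPEC IN ONE THEOREM (lead c12, cycle 1; `--supports`)

After fourteen lead seats the state of this crux is: the composition is kernel-checked, every provable reduction is landed,
and what is left are three NAMED statements, none of which is a theorem or a named fact of the tree.  This file states the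
crux BY NAME as a consequence of exactly those three, each typed verbatim as it is consumed, so that a planner reads the
residual off ONE signature instead of out of twenty support files:

* `h16903` — item stmt-QuantumFields-16903 `EulerDescent.RetypedContinuumComplement` (light-quark CONTINUATION of the
  continuum construction into certified-gapped territory; the registered stub Q3 `stub_bodyIntoGap` is its local instance,
  `Lines/gap_upset_recut.lean` §4);
* `hD` — SUPERCRITICAL WALL DECOUPLING (unfiled; the `needs:` of the registered stub W_lim `stub_wallLimitNoGo`, reduction
  `WallLimitNoGo.stub_wallLimitNoGo_of_wallDecoupling`, p154431): along a mass-scaling regularisation with `m_crit(k) → −1`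
  every OS datum that is QCD along one of its schemes has trivial flavour-changing pseudoscalars;
* `hRS` — RAY-SOFT POINT (unfiled; verbatim the registered stub RS `stub_raySoftPoint`, promoted by lead a1): an interior
  mass-scaling regularisation carrying the body above some offset has an offset `ν₀` with Euler / Feynman–Hellmann descent of
  the lattice rates along rays from `ν₀·𝟙` and NO uniform lattice rate above `ν₀` (Goldstone / anomaly softness).

`chiralDescent_of_continuumComplement_of_wallDecoupling_of_raySoftPoint` : crux ⇐ h16903 ∧ hD ∧ hRS (composition of
p151828 `chiralDescent_of_wallNoGo_of_raySoftPoint_of_continuumComplement`, p149855 `WallLimit.wallNoGo_of_wallLimitNoGo`,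
p154431).  `qcdOf_of_interiorThreshold_of_continuumComplement_of_raySoftPoint` : under the INTERIOR re-type of the
antecedent (`∃ c > −1, ∀ᶠ k, c ≤ m_crit k`, free for every honest bridge) the wall hypothesis `hD` is not needed at all.
Both are CONDITIONAL bookkeeping theorems (standard axioms); nothing physical is proved here.
-/

namespace Summit.QuantumFields.QCD.Cruxes.ChiralDescent.GapUpsetRecut

open Filter Topology
open Literature.MathematicalPhysics.QuantumFieldTheory

/-- **The crux BY NAME from the three residual statements** — continuation (item 16903), supercritical wall decoupling
(`hD`, unfiled) and the ray-soft point (`hRS`, the registered stub RS) — each typed verbatim as consumed.  Registered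
sub-goal of stmt-QuantumFields-17527. [folklore] -/
theorem chiralDescent_of_continuumComplement_of_wallDecoupling_of_raySoftPoint :
    ∀ (h16903 : Theses.EulerDescent.RetypedContinuumComplement)
    (hD : ∀ Nf : ℕ, (Nf = 2 ∨ Nf = 3) → ∀ reg : QCDRegularisation Nf, reg.HasMassScaling →
      Tendsto reg.mcrit atTop (nhds (-1)) → ∀ (m : Fin Nf → ℝ) (z shift : QCDField Nf → ℕ → ℝ)
      (T : OSData (QCDField Nf) 4), IsQCDAlong (reg.scheme m z shift) T →
      ∀ f g : Fin Nf, f ≠ g → ¬ T.IsNontrivial (QCDField.pseudoRe f g))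
    (hRS : ∀ Nf : ℕ, (Nf = 2 ∨ Nf = 3) → ∀ reg : QCDRegularisation Nf, reg.HasMassScaling →
      (∃ c : ℝ, -1 < c ∧ ∀ᶠ k in atTop, c ≤ reg.mcrit k) → ∀ μ : ℝ,
      (∀ m : Fin Nf → ℝ, (∀ f, μ < m f) →
        ∃ (z shift : QCDField Nf → ℕ → ℝ) (T : OSData (QCDField Nf) 4),
          IsQCDAlong (reg.scheme m z shift) T ∧ T.IsNontrivial QCDField.glue ∧ T.IsNonGaussian QCDField.glue ∧
            (∀ f g : Fin Nf, f ≠ g → T.IsNontrivial (QCDField.pseudoRe f g)) ∧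
              ∃ Δ > 0, T.HasMassGap Δ ∧ (reg.scheme m z shift).HasLatticeMassGap Δ) →
      ∃ ν₀ : ℝ,
        (∀ m : Fin Nf → ℝ, (∀ f, 0 < m f) → ∀ l : ℝ, 1 ≤ l → ∀ Δ : ℝ, 0 < Δ →
          (reg.scheme (fun f => ν₀ + l * m f) 0 0).HasLatticeMassGap Δ → ∀ Δ' : ℝ, 0 < Δ' → Δ' < Δ / l →
            (reg.scheme (fun f => ν₀ + m f) 0 0).HasLatticeMassGap Δ') ∧
        (∀ ε > (0 : ℝ), ∃ m : Fin Nf → ℝ, (∀ f, 0 < m f) ∧ ¬ (reg.scheme (fun f => ν₀ + m f) 0 0).HasLatticeMassGap ε)),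
    Summit.QuantumFields.QCD.Theses.SpectralDefectExtinction.ChiralDescent :=
  fun h16903 hD hRS =>
    chiralDescent_of_wallNoGo_of_raySoftPoint_of_continuumComplement h16903
      (WallLimit.wallNoGo_of_wallLimitNoGo (WallLimitNoGo.stub_wallLimitNoGo_of_wallDecoupling hD)) hRS

/-- **Under the INTERIOR re-type of the antecedent the wall statement drops out**: for `N_f ∈ {2,3}`, threshold massive
QCD along one INTERIOR mass-scaling regularisation (`∃ c > −1, ∀ᶠ k, c ≤ m_crit k`) implies the re-typed `QCDOf N_f` from
continuation (item 16903) and the ray-soft point alone.  Registered sub-goal of stmt-QuantumFields-17527. [folklore] -/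
theorem qcdOf_of_interiorThreshold_of_continuumComplement_of_raySoftPoint :
    ∀ (h16903 : Theses.EulerDescent.RetypedContinuumComplement)
    (hRS : ∀ Nf : ℕ, (Nf = 2 ∨ Nf = 3) → ∀ reg : QCDRegularisation Nf, reg.HasMassScaling →
      (∃ c : ℝ, -1 < c ∧ ∀ᶠ k in atTop, c ≤ reg.mcrit k) → ∀ μ : ℝ,
      (∀ m : Fin Nf → ℝ, (∀ f, μ < m f) →
        ∃ (z shift : QCDField Nf → ℕ → ℝ) (T : OSData (QCDField Nf) 4),
          IsQCDAlong (reg.scheme m z shift) T ∧ T.IsNontrivial QCDField.glue ∧ T.IsNonGaussian QCDField.glue ∧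
            (∀ f g : Fin Nf, f ≠ g → T.IsNontrivial (QCDField.pseudoRe f g)) ∧
              ∃ Δ > 0, T.HasMassGap Δ ∧ (reg.scheme m z shift).HasLatticeMassGap Δ) →
      ∃ ν₀ : ℝ,
        (∀ m : Fin Nf → ℝ, (∀ f, 0 < m f) → ∀ l : ℝ, 1 ≤ l → ∀ Δ : ℝ, 0 < Δ →
          (reg.scheme (fun f => ν₀ + l * m f) 0 0).HasLatticeMassGap Δ → ∀ Δ' : ℝ, 0 < Δ' → Δ' < Δ / l →
            (reg.scheme (fun f => ν₀ + m f) 0 0).HasLatticeMassGap Δ') ∧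
        (∀ ε > (0 : ℝ), ∃ m : Fin Nf → ℝ, (∀ f, 0 < m f) ∧ ¬ (reg.scheme (fun f => ν₀ + m f) 0 0).HasLatticeMassGap ε)),
    ∀ Nf : ℕ, (Nf = 2 ∨ Nf = 3) →
      (∃ reg : QCDRegularisation Nf, reg.HasMassScaling ∧ (∃ c : ℝ, -1 < c ∧ ∀ᶠ k in atTop, c ≤ reg.mcrit k) ∧
        ∃ M₁ : ℝ, 0 ≤ M₁ ∧ ∀ m : Fin Nf → ℝ, (∀ f, M₁ < m f) →
          ∃ (z shift : QCDField Nf → ℕ → ℝ) (T : OSData (QCDField Nf) 4),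
            IsQCDAlong (reg.scheme m z shift) T ∧ T.IsNontrivial QCDField.glue ∧ T.IsNonGaussian QCDField.glue ∧
              (∀ f g : Fin Nf, f ≠ g → T.IsNontrivial (QCDField.pseudoRe f g)) ∧
                ∃ Δ > 0, T.HasMassGap Δ ∧ (reg.scheme m z shift).HasLatticeMassGap Δ) →
      QCDOf Nf := by
  rintro h16903 hRS Nf hNf ⟨reg, hMS, hint, M₁, -, hbody⟩
  obtain ⟨ν₀, hray, hsoft⟩ := hRS Nf hNf reg hMS hint M₁ hbody
  exact qcdOf_of_raySoftPoint_of_continuumComplement h16903 hNf reg hMS hint hbody hray hsoft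

end Summit.QuantumFields.QCD.Cruxes.ChiralDescent.GapUpsetRecut
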